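import Summits.ResolutionOfSingularities.ResolutionOfSingularities.Theorems.HilbertSamuelEliminationSigmaMaxModificationsCorridor3SigmaTameLowContact
import Literature.AlgebraicGeometry.Resolution.BlowupRestrictOpen
import Literature.AlgebraicGeometry.Resolution.BlowupOffCentre
import Literature.AlgebraicGeometry.Resolution.BlowupDisjointCentreWeights
import Literature.AlgebraicGeometry.Resolution.AlterationsProofs
import HarnessLib

/-!
# [OURS · L1 W4.2] σ-LAYER — `Corridor3SigmaPersistentContactCover`: the (T-adapt)/(G-glob) SOCKET — a FINITE cover of the `S₀`-fold locus by
# DIFF-CONTACT CHARTS (an open `U` of the ambient with a weight-one contact ideal sheaf `H` on it: `H ⊆ Diff^{≤S₀−1}(N|_U)`, order-one stalk generators,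
# `Sing_{S₀}(N) ∩ U ⊆ V(H)`), and its TRANSPORT along a blow-up in a regular centre inside `Sing_{S₀}(N)` — PROVED from res-D-pv-060's T-L1
# persistence (`IsBlowup.diffContactChart_transform`, p557013) and the tree's restriction kit (`IsBlowup.morphismRestrict`, `controlledTransform_morphismRestrict`,
# `BlowupRestrictOpen.lean`); the EXISTENCE of such a cover at instance start (T-L1 `exists_diffContactChart_of_not_dvd` at every closed point + Jacobson +
# quasi-compactness) is the socket's instance — statement recorded, proof = v2 (this file's §4 docstring)
# (crux chain w42 `SigmaMaxModifications` stmt-ResolutionOfSingularities-18506 / conjunct `SigmaMaxModificationsCorridor3` stmt-ResolutionOfSingularities-19249;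
# res-L1-w42-plan-1 RULING v3.14-51 (51C) «then `…Corridor3SigmaPersistentContactCover.lean` ((T-adapt)/(G-glob) socket: finite affine cover of X_max at instance
# start by diff-contact charts — T-L1 pointwise + quasi-compactness — transported by `diffContactChart_transform` ✓; 𝓑 ∪ H snc by induction over moves)»;
# consumers: idea-1's `RowRunFrame` (τ read in the persistent contact chart), o1's P-MODE gate; seat res-L1-type-o2 g9 = «res-type-067/068 SUCCESSOR»;
# `--supports stmt-ResolutionOfSingularities-19249 --as helper`, counted 0)

HONEST FRAMING. OURS packaging; the mathematics is 060's T-L1 (Giraud / BGMW Lemma 3.6.4 (3)–(5) on Grothendieck's `Diff^{≤n}`) and the restriction kit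
(Görtz–Wedhorn I Prop. 13.91, BGMW §3.2), all PROVED in the tree. Two `structure`s (data) + two `def`s (the transports) + PROVED lemmas; no named fact, no axiom,
no instance, no notation. NOTHING here is a statement of H. Hironaka's manuscript [Hironaka2017] nor of Cutkosky 2009 / Cossart–Jannsen–Saito. AI-typed; AI
review weaker than expert review.

## Contents (namespace `…Theorems.SigmaMaxModificationsCorridor3.Sigma`)

* §1 **`ContactChart φ N S₀`** — an open `U ⊆ W` and an ideal sheaf `H` on the open subscheme `↑U` with (c1) `H ≤ Diff^{≤S₀−1}(N|_U)` (for the restricted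
  `K`-structure `U.ι^* ∘ φ`), (c2) order-ONE stalk generators at every point of `V(H)`, (c3) `Sing_{S₀}(N|_U) ⊆ V(H)` — exactly the shape 060's persistence
  theorem consumes and produces; `ContactChart.mem_support_of_le_idealOrder` (a point of `U` of `N`-order `≥ S₀` lies on `V(H)`, orders read on `W`).
* §2 **`ContactCover φ N S₀`** — finitely many charts (`Fin n`) whose opens cover `Sing_{S₀}(N) = {y | S₀ ≤ ord_y N}`.
* §3 TRANSPORT, PROVED: `restrictedStructure_eq` (the two `K`-structures on `τ⁻¹(U)` agree: `(τ∣_U)^* ∘ U.ι^* ∘ φ = (τ⁻¹U).ι^* ∘ τ^* ∘ φ`),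
  **`ContactChart.transform`** (along a blow-up `τ : W′ → W` in a REGULAR centre `C ⊆ Sing_{S₀}(N)` of a regular `W`: the chart `(τ⁻¹U, (τ∣_U)ᶜ(H,1))` of
  `(W′, τ^*∘φ, N′ := τᶜ(N, S₀))` — 060's `IsBlowup.diffContactChart_transform` on the open subscheme, `IsBlowup.morphismRestrict`,
  `controlledTransform_morphismRestrict`, `Scheme.IsRegular.of_isOpenImmersion` / `subscheme_comap_of_isOpenImmersion`, `idealOrder_comap_of_isOpenImmersion`),
  **`ContactCover.transform`** (chartwise; the cover property persists because off the centre the order of the controlled transform is the order below —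
  `IsBlowup.idealOrder_controlledTransform_of_not_mem` — and the centre lies in `Sing_{S₀}(N)`), `ContactCover.transform_n` (same number of charts).
* §4 EXISTENCE SOCKET (statement recorded as `ContactCover.ExistsAtStart`, a `Prop` the instance owes; its proof — T-L1 `exists_diffContactChart_of_not_dvd` at
  every CLOSED point of `Sing_{S₀}(N)` (smooth over a perfect field, `p ∤ S₀`, order exactly `S₀` there), the generated ideal sheaf on the affine `↑U`,
  `comap_diffIdealSheaf_of_isOpenImmersion`, Jacobson density of closed points (`nonempty_inter_closedPoints`) and quasi-compactness of the closed `S₀`-fold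
  locus — is v2 of this file). «𝓑 ∪ H snc by induction over moves» is NOT claimed here (T-L1 claims no transversality; RULING -48 (PD)(i)).

VACUITY SELF-CHECK. The structures are inhabited on any regular `W` where T-L1's existence applies (e.g. one chart on an affine `W`); `transform` has content
(its output's three clauses are 060's theorem, not definitional).
-/

noncomputable section

set_option linter.dupNamespace false -- mandated namespace of this single-conjunct summit

open CategoryTheory AlgebraicGeometry TopologicalSpace IsLocalRing
open Literature.AlgebraicGeometry.Resolution
open Summit.ResolutionOfSingularities.ResolutionOfSingularities.Theorems.SigmaMaxModificationsCorridor3.Helpers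

namespace Summit.ResolutionOfSingularities.ResolutionOfSingularities.Theorems.SigmaMaxModificationsCorridor3.Sigma

universe u v

variable {K : Type v} [Field K]

/-! ## §1. Diff-contact charts -/

/-- [OURS · L1 W4.2] **A DIFF-CONTACT CHART** for `(W, φ, N, S₀)`: an open `U ⊆ W` and a contact ideal sheaf `H` on the open subscheme `↑U` — locally
`H = (z)`, `z ∈ Diff^{≤S₀−1}(N)(U)` of order one — with (c1) `H ≤ Diff^{≤S₀−1}(N|_U)`, (c2) order-one stalk generators on `V(H)`, (c3)
`Sing_{S₀}(N|_U) ⊆ V(H)`. The conclusion shape of T-L1 (`exists_diffContactChart_of_not_dvd`, `IsBlowup.diffContactChart_transform`). NOT a statement of the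
manuscript. [folklore] -/
structure ContactChart {W : Scheme.{u}} (φ : K →+* Γ(W, ⊤)) (N : W.IdealSheafData) (S₀ : ℕ) where
  /-- the open of the chart -/
  U : W.Opens
  /-- the contact ideal sheaf on the open subscheme -/
  H : (U : Scheme.{u}).IdealSheafData
  /-- (c1) `H ⊆ Diff^{≤S₀−1}(N|_U)` -/
  le_diff : H ≤ diffIdealSheaf (U.ι.appTop.hom.comp φ) (S₀ - 1) (N.comap U.ι)
  /-- (c2) order-one stalk generators on `V(H)` -/
  order_one : ∀ x ∈ H.support, ∃ v : (U : Scheme.{u}).presheaf.stalk x,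
    stalkIdeal H x = Ideal.span {v} ∧ v ∉ (maximalIdeal ((U : Scheme.{u}).presheaf.stalk x)) ^ 2
  /-- (c3) `Sing_{S₀}(N|_U) ⊆ V(H)` -/
  sing_subset : {x : (U : Scheme.{u}) | (S₀ : ℕ∞) ≤ idealOrder (N.comap U.ι) x} ⊆ (H.support : Set (U : Scheme.{u}))

namespace ContactChart

variable {W : Scheme.{u}} {φ : K →+* Γ(W, ⊤)} {N : W.IdealSheafData} {S₀ : ℕ} (ch : ContactChart φ N S₀)

/-- A point of the chart's open whose `N`-order (read on `W`) is `≥ S₀` lies on `V(H)`. [folklore] -/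
theorem mem_support_of_le_idealOrder (x : (ch.U : Scheme.{u})) (hx : (S₀ : ℕ∞) ≤ idealOrder N (ch.U.ι x)) :
    x ∈ (ch.H.support : Set (ch.U : Scheme.{u})) := by
  apply ch.sing_subset
  rw [Set.mem_setOf_eq, idealOrder_comap_of_isOpenImmersion]
  exact hx

end ContactChart

/-! ## §2. Finite contact covers of the `S₀`-fold locus -/

/-- [OURS · L1 W4.2] **A PERSISTENT CONTACT COVER** of `(W, φ, N, S₀)`: finitely many diff-contact charts whose opens cover the `S₀`-fold locus
`Sing_{S₀}(N) = {y | S₀ ≤ ord_y N}` (on the tame row of record, `= {ord_y N = S₀}` by maximality). The (T-adapt)/(G-glob) socket of RULING v3.14-51 (51C).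
NOT a statement of the manuscript. [folklore] -/
structure ContactCover {W : Scheme.{u}} (φ : K →+* Γ(W, ⊤)) (N : W.IdealSheafData) (S₀ : ℕ) where
  /-- number of charts -/
  n : ℕ
  /-- the charts -/
  chart : Fin n → ContactChart φ N S₀
  /-- the opens cover the `S₀`-fold locus -/
  covers : {y : W | (S₀ : ℕ∞) ≤ idealOrder N y} ⊆ ⋃ i, ((chart i).U : Set W)

/-! ## §3. Transport along a blow-up in a regular centre inside the `S₀`-fold locus -/

section Transport

variable {W W' : Scheme.{u}} {φ : K →+* Γ(W, ⊤)} {τ : W' ⟶ W} {C N : W.IdealSheafData} {S₀ : ℕ}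

/-- **The two `K`-structures on `τ⁻¹(U)` agree**: restricting `φ` to `U` then pulling back along `τ ∣_ U` is pulling back along `τ` then restricting to
`τ⁻¹(U)` (the square `τ∣_U ≫ U.ι = (τ⁻¹U).ι ≫ τ`, Mathlib `morphismRestrict_ι`). [folklore] -/
theorem restrictedStructure_eq (U : W.Opens) :
    (τ ∣_ U).appTop.hom.comp (U.ι.appTop.hom.comp φ) = (τ ⁻¹ᵁ U).ι.appTop.hom.comp (τ.appTop.hom.comp φ) := by
  rw [← RingHom.comp_assoc, ← RingHom.comp_assoc, ← CommRingCat.hom_comp, ← CommRingCat.hom_comp, ← Scheme.Hom.comp_appTop,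
    ← Scheme.Hom.comp_appTop, morphismRestrict_ι]

/-- The restricted centre lies in the `S₀`-fold locus of `N|_U` when the centre lies in that of `N`. [folklore] -/
theorem forall_mem_support_comap_le_idealOrder (hsupp : ∀ y ∈ C.support, (S₀ : ℕ∞) ≤ idealOrder N y) (U : W.Opens) :
    ∀ y ∈ (C.comap U.ι).support, (S₀ : ℕ∞) ≤ idealOrder (N.comap U.ι) y := by
  intro y hy
  rw [idealOrder_comap_of_isOpenImmersion]
  exact hsupp _ ((mem_support_comap_iff U.ι C y).mp hy)

/-- **Points of the `S₀`-fold locus of the controlled transform lie over the `S₀`-fold locus of `N`** (off the centre the orders agree —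
`IsBlowup.idealOrder_controlledTransform_of_not_mem`; the centre itself lies in the locus). [folklore] -/
theorem le_idealOrder_base_of_le_idealOrder_controlledTransform (hτ : IsBlowup τ C) (hsupp : ∀ y ∈ C.support, (S₀ : ℕ∞) ≤ idealOrder N y)
    {y' : W'} (hy' : (S₀ : ℕ∞) ≤ idealOrder (controlledTransform τ C N S₀) y') : (S₀ : ℕ∞) ≤ idealOrder N (τ y') := by
  by_cases hmem : τ y' ∈ (C.support : Set W)
  · exact hsupp _ hmem
  · rwa [hτ.idealOrder_controlledTransform_of_not_mem N S₀ hmem] at hy'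

variable [IsLocallyNoetherian W] [IsLocallyNoetherian W']

/-- [OURS · L1 W4.2] **TRANSPORT OF A CONTACT CHART along a blow-up in a regular centre inside `Sing_{S₀}(N)`** (060's T-L1 persistence run on the open
subscheme `↑U` with the restricted blow-up `τ ∣_ U`): the chart `(τ⁻¹U, (τ∣_U)ᶜ(H, 1))` of `(W′, τ^*∘φ, τᶜ(N, S₀), S₀)`. Binders: finite-type sections of the
two restricted `K`-structures (`hasFiniteTypeSections_of_locallyOfFiniteType` discharges them over a field), `τ` a blow-up along `C`, `W` and `V(C)` regular,
`1 ≤ S₀`, `V(C) ⊆ Sing_{S₀}(N)`. [folklore] -/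
def ContactChart.transform (ch : ContactChart φ N S₀) (hUs : HasFiniteTypeSections (ch.U.ι.appTop.hom.comp φ))
    (hU's : HasFiniteTypeSections ((τ ∣_ ch.U).appTop.hom.comp (ch.U.ι.appTop.hom.comp φ))) (hτ : IsBlowup τ C) (hW : Scheme.IsRegular W)
    (hC : Scheme.IsRegular C.subscheme) (hS : 1 ≤ S₀) (hsupp : ∀ y ∈ C.support, (S₀ : ℕ∞) ≤ idealOrder N y) :
    ContactChart (τ.appTop.hom.comp φ) (controlledTransform τ C N S₀) S₀ := by
  have hU : Scheme.IsRegular (ch.U : Scheme.{u}) := Scheme.IsRegular.of_isOpenImmersion ch.U.ι hW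
  have hCU : Scheme.IsRegular (C.comap ch.U.ι).subscheme := Scheme.IsRegular.subscheme_comap_of_isOpenImmersion ch.U.ι hC
  have h := Helpers.IsBlowup.diffContactChart_transform hUs hU's (IsBlowup.morphismRestrict τ ch.U hτ) hU hCU (N.comap ch.U.ι) hS
    (forall_mem_support_comap_le_idealOrder hsupp ch.U) ch.le_diff ch.order_one
  refine
    { U := τ ⁻¹ᵁ ch.U
      H := controlledTransform (τ ∣_ ch.U) (C.comap ch.U.ι) ch.H 1
      le_diff := ?_
      order_one := h.2.1
      sing_subset := ?_ }
  · rw [← restrictedStructure_eq, ← controlledTransform_morphismRestrict]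
    exact h.1
  · rw [← controlledTransform_morphismRestrict]
    exact h.2.2.1

/-- The transported chart's open is `τ⁻¹(U)`. [folklore] -/
theorem ContactChart.transform_U (ch : ContactChart φ N S₀) (hUs : HasFiniteTypeSections (ch.U.ι.appTop.hom.comp φ))
    (hU's : HasFiniteTypeSections ((τ ∣_ ch.U).appTop.hom.comp (ch.U.ι.appTop.hom.comp φ))) (hτ : IsBlowup τ C) (hW : Scheme.IsRegular W)
    (hC : Scheme.IsRegular C.subscheme) (hS : 1 ≤ S₀) (hsupp : ∀ y ∈ C.support, (S₀ : ℕ∞) ≤ idealOrder N y) :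
    (ch.transform hUs hU's hτ hW hC hS hsupp).U = τ ⁻¹ᵁ ch.U := rfl

/-- [OURS · L1 W4.2] **TRANSPORT OF A CONTACT COVER**: chartwise transport; the cover property persists. [folklore] -/
def ContactCover.transform (cov : ContactCover φ N S₀) (hWs : ∀ U : W.Opens, HasFiniteTypeSections (U.ι.appTop.hom.comp φ))
    (hW's : ∀ U : W.Opens, HasFiniteTypeSections ((τ ∣_ U).appTop.hom.comp (U.ι.appTop.hom.comp φ))) (hτ : IsBlowup τ C)
    (hW : Scheme.IsRegular W) (hC : Scheme.IsRegular C.subscheme) (hS : 1 ≤ S₀) (hsupp : ∀ y ∈ C.support, (S₀ : ℕ∞) ≤ idealOrder N y) :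
    ContactCover (τ.appTop.hom.comp φ) (controlledTransform τ C N S₀) S₀ where
  n := cov.n
  chart i := (cov.chart i).transform (hWs _) (hW's _) hτ hW hC hS hsupp
  covers := by
    intro y' hy'
    have hy := cov.covers (le_idealOrder_base_of_le_idealOrder_controlledTransform hτ hsupp hy')
    obtain ⟨i, hi⟩ := Set.mem_iUnion.mp hy
    exact Set.mem_iUnion.mpr ⟨i, hi⟩

/-- The number of charts is unchanged by the transport. [folklore] -/
theorem ContactCover.transform_n (cov : ContactCover φ N S₀) (hWs : ∀ U : W.Opens, HasFiniteTypeSections (U.ι.appTop.hom.comp φ))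
    (hW's : ∀ U : W.Opens, HasFiniteTypeSections ((τ ∣_ U).appTop.hom.comp (U.ι.appTop.hom.comp φ))) (hτ : IsBlowup τ C)
    (hW : Scheme.IsRegular W) (hC : Scheme.IsRegular C.subscheme) (hS : 1 ≤ S₀) (hsupp : ∀ y ∈ C.support, (S₀ : ℕ∞) ≤ idealOrder N y) :
    (cov.transform hWs hW's hτ hW hC hS hsupp).n = cov.n := rfl

end Transport

/-! ## §4. The existence socket (instance owed; proof = v2) -/

/-- [OURS · L1 W4.2] **EXISTENCE SOCKET**: «`(W, φ, N, S₀)` admits a persistent contact cover». The INSTANCE of record (v2 of this file / the realisation):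
`W` smooth and quasi-compact over a PERFECT field `K` of characteristic `p`, `p ∤ S₀`, every point of the `S₀`-fold locus of order EXACTLY `S₀` (the tame row's
maximality) ⇒ T-L1 `exists_diffContactChart_of_not_dvd` at each CLOSED point of the locus gives a chart; closed points are dense in the closed locus (Jacobson),
so the opens cover it; quasi-compactness extracts finitely many. NOT a statement of the manuscript. [folklore] -/
def ContactCover.ExistsAtStart {W : Scheme.{u}} (φ : K →+* Γ(W, ⊤)) (N : W.IdealSheafData) (S₀ : ℕ) : Prop :=
  Nonempty (ContactCover φ N S₀)

/-- Along a blow-up in a regular centre inside the locus, existence persists (by `transform`). [folklore] -/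
theorem ContactCover.ExistsAtStart.transform {W W' : Scheme.{u}} [IsLocallyNoetherian W] [IsLocallyNoetherian W'] {φ : K →+* Γ(W, ⊤)} {τ : W' ⟶ W}
    {C N : W.IdealSheafData} {S₀ : ℕ} (h : ContactCover.ExistsAtStart φ N S₀)
    (hWs : ∀ U : W.Opens, HasFiniteTypeSections (U.ι.appTop.hom.comp φ))
    (hW's : ∀ U : W.Opens, HasFiniteTypeSections ((τ ∣_ U).appTop.hom.comp (U.ι.appTop.hom.comp φ)))
    (hτ : IsBlowup τ C) (hW : Scheme.IsRegular W) (hC : Scheme.IsRegular C.subscheme) (hS : 1 ≤ S₀)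
    (hsupp : ∀ y ∈ C.support, (S₀ : ℕ∞) ≤ idealOrder N y) :
    ContactCover.ExistsAtStart (τ.appTop.hom.comp φ) (controlledTransform τ C N S₀) S₀ :=
  ⟨h.some.transform hWs hW's hτ hW hC hS hsupp⟩

end Summit.ResolutionOfSingularities.ResolutionOfSingularities.Theorems.SigmaMaxModificationsCorridor3.Sigma

end
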